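import Mathlib
import Literature.Computability.AlgebraicComplexity.ArithCircuitProofs
import Literature.Computability.AlgebraicComplexity.MatMulTotalComplexityProofs
import Literature.Computability.AlgebraicComplexity.FastFourierTransform
import Literature.LinearAlgebra.Matrix.CauchyDeterminant
import Literature.Computability.AlgebraicComplexity.DivisionSLP
import Literature.LinearAlgebra.Matrix.CauchyLike
import Summits.MatrixMultiplication.MatrixMultiplication.Theorems.HiddenToeplitzCornersToeplitzLikeDetCostConversionAux
import Summits.MatrixMultiplication.MatrixMultiplication.Theorems.HiddenToeplitzCornersToeplitzLikeDetCostConversionAuxDFT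

/-!
# Stub `stub_conversion` of crux `HiddenToeplitzCorners.ToeplitzLikeDetCost` (stmt-MatrixMultiplication-7491),
# line `Sketch`

Toeplitz-like (Stein) generators to Cauchy-like generators by twisted DFTs (K-level).

Target tree file: `Summits/MatrixMultiplication/MatrixMultiplication/Theorems/HiddenToeplitzCornersToeplitzLikeDetCostConversion.lean`
(helper for the crux, landed with `--supports stmt-MatrixMultiplication-7491`). The theorem `stub_conversion`
below must keep EXACTLY this name and signature (it is registered on the crux).
-/

set_option linter.dupNamespace false

namespace Summit.MatrixMultiplication.MatrixMultiplication.Theorems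

open scoped BigOperators Matrix
open Literature.Computability.AlgebraicComplexity Literature.LinearAlgebra.Matrix
open Literature.Computability.AlgebraicComplexity.ArithCircuit (FanInTwoSeq freeInputs)

noncomputable section

section KLevel
variable {K : Type} [Field K] [Algebra ℂ K]

/-- **Cost of the Cauchy-like generator columns** (Pan 2001, §4.7): from the Stein generator
`(P, Q)` one computes the last column, last row and first column of `T` by `2β` fast polynomial
products (`hpm`) and `O(β n)` further operations, hence the non-trivial columns
`Z (T e_last) - f (T e₀)`, `e (e_lastᵀ T)` and `-P` of the generator `(G', H')`.
[cite: Pan2001, §4.7] -/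
theorem conv_cost_generators
    (hpm : ∀ (n : ℕ) (u v : Fin n → K) (A : Set K),
      (∀ i, u i ∈ A ∪ Set.range (algebraMap ℂ K)) → (∀ i, v i ∈ A ∪ Set.range (algebraMap ℂ K)) →
      Derivable ℂ (16 * n * (Nat.log 2 n + 4)) A
        {w | ∃ m : ℕ, w = ∑ i : Fin n, ∑ j : Fin n, if (i : ℕ) + j = m then u i * v j else 0})
    (κ β : ℕ) {e f : K} (he : e ∈ Set.range (algebraMap ℂ K))
    (hf : f ∈ Set.range (algebraMap ℂ K)) (P Q : Matrix (Fin (2 ^ κ)) (Fin β) K) (A : Set K)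
    (hP : ∀ i k, P i k ∈ A ∪ Set.range (algebraMap ℂ K))
    (hQ : ∀ i k, Q i k ∈ A ∪ Set.range (algebraMap ℂ K)) :
    Derivable ℂ (32 * β * 2 ^ κ * (κ + 4) + (5 * β + 2) * 2 ^ κ) A
      (Set.range (fun i : Fin (2 ^ κ) =>
          (Matrix.of fun i j : Fin (2 ^ κ) => if (i : ℕ) = (j : ℕ) + 1 then (1 : K) else 0).mulVec
              (fun i => ∑ k : Fin β, ∑ a : Fin (2 ^ κ), ∑ b : Fin (2 ^ κ),
                if (a : ℕ) + b = i then P a k * Q (Fin.rev b) k else 0) i -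
            f * ∑ k : Fin β, P i k * Q 0 k) ∪
        Set.range (fun j : Fin (2 ^ κ) => e * ∑ k : Fin β, ∑ a : Fin (2 ^ κ), ∑ b : Fin (2 ^ κ),
            if (a : ℕ) + b = j then P (Fin.rev a) k * Q b k else 0) ∪
        Set.range (fun ik : Fin (2 ^ κ) × Fin β => -P ik.1 ik.2)) := by
  obtain ⟨ce, rfl⟩ := he
  obtain ⟨cf, rfl⟩ := hf
  have liftA : ∀ {x : K} {S B : Set K}, x ∈ S ∪ Set.range (algebraMap ℂ K) →
      x ∈ S ∪ B ∪ Set.range (algebraMap ℂ K) :=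
    fun h => h.elim (fun h => Or.inl (Or.inl h)) Or.inr
  set cL : Fin (2 ^ κ) → K := fun i => ∑ k : Fin β, ∑ a : Fin (2 ^ κ), ∑ b : Fin (2 ^ κ),
      if (a : ℕ) + b = i then P a k * Q (Fin.rev b) k else 0 with hcL
  -- Stage 1: the `2β` polynomial products
  set B1 : Set K :=
    (⋃ k ∈ (Finset.univ : Finset (Fin β)), {w | ∃ m : ℕ, w = ∑ a : Fin (2 ^ κ), ∑ b : Fin (2 ^ κ),
        if (a : ℕ) + b = m then P a k * Q (Fin.rev b) k else 0}) ∪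
    (⋃ k ∈ (Finset.univ : Finset (Fin β)), {w | ∃ m : ℕ, w = ∑ a : Fin (2 ^ κ), ∑ b : Fin (2 ^ κ),
        if (a : ℕ) + b = m then P (Fin.rev a) k * Q b k else 0}) with hB1
  have h1 : Derivable ℂ (32 * β * 2 ^ κ * (κ + 4)) A B1 := by
    have hlog : Nat.log 2 (2 ^ κ) = κ := Nat.log_pow (by norm_num) κ
    have hA := Derivable.biUnion (k := ℂ) (Finset.univ : Finset (Fin β)) fun k _ =>
      hpm (2 ^ κ) (fun a => P a k) (fun b => Q (Fin.rev b) k) A (fun a => hP a k) fun b => hQ _ k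
    have hB := Derivable.biUnion (k := ℂ) (Finset.univ : Finset (Fin β)) fun k _ =>
      hpm (2 ^ κ) (fun a => P (Fin.rev a) k) (fun b => Q b k) A (fun a => hP _ k) fun b => hQ b k
    refine (hA.union hB).mono (le_of_eq ?_) subset_rfl subset_rfl
    rw [Finset.sum_const, Finset.card_univ, Fintype.card_fin, smul_eq_mul, hlog]
    ring
  -- Stage 2: last column, last row (sums of `β` terms) and the products `P i k * Q 0 k`
  set B2 : Set K := (⋃ i ∈ (Finset.univ : Finset (Fin (2 ^ κ))), {cL i}) ∪
    (⋃ j ∈ (Finset.univ : Finset (Fin (2 ^ κ))), {∑ k : Fin β, ∑ a : Fin (2 ^ κ),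
      ∑ b : Fin (2 ^ κ), if (a : ℕ) + b = j then P (Fin.rev a) k * Q b k else 0}) ∪
    (⋃ ik ∈ (Finset.univ : Finset (Fin (2 ^ κ) × Fin β)), {P ik.1 ik.2 * Q 0 ik.2}) with hB2
  have h2 : Derivable ℂ (3 * (2 ^ κ * β)) (A ∪ B1) B2 := by
    have hc : ∀ i : Fin (2 ^ κ), Derivable ℂ β (A ∪ B1) {cL i} := by
      intro i
      have h := Derivable.sum (k := ℂ) (A := A ∪ B1) (Finset.univ : Finset (Fin β))
        (fun _ => (1 : ℂ)) (x := fun k => ∑ a : Fin (2 ^ κ), ∑ b : Fin (2 ^ κ),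
          if (a : ℕ) + b = i then P a k * Q (Fin.rev b) k else 0) fun k _ =>
          Or.inl (Or.inr (Or.inl (Set.mem_iUnion₂.2 ⟨k, Finset.mem_univ _, (i : ℕ), rfl⟩)))
      rw [Finset.card_univ, Fintype.card_fin] at h
      simpa only [one_smul] using h
    have hr : ∀ j : Fin (2 ^ κ), Derivable ℂ β (A ∪ B1) {∑ k : Fin β, ∑ a : Fin (2 ^ κ),
        ∑ b : Fin (2 ^ κ), if (a : ℕ) + b = j then P (Fin.rev a) k * Q b k else 0} := by
      intro j
      have h := Derivable.sum (k := ℂ) (A := A ∪ B1) (Finset.univ : Finset (Fin β))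
        (fun _ => (1 : ℂ)) (x := fun k => ∑ a : Fin (2 ^ κ), ∑ b : Fin (2 ^ κ),
          if (a : ℕ) + b = j then P (Fin.rev a) k * Q b k else 0) fun k _ =>
          Or.inl (Or.inr (Or.inr (Set.mem_iUnion₂.2 ⟨k, Finset.mem_univ _, (j : ℕ), rfl⟩)))
      rw [Finset.card_univ, Fintype.card_fin] at h
      simpa only [one_smul] using h
    have hp : ∀ ik : Fin (2 ^ κ) × Fin β, Derivable ℂ 1 (A ∪ B1) {P ik.1 ik.2 * Q 0 ik.2} :=
      fun ik => Derivable.mul (liftA (hP _ _)) (liftA (hQ _ _))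
    have hall := ((Derivable.biUnion (Finset.univ : Finset (Fin (2 ^ κ))) fun i _ => hc i).union
      (Derivable.biUnion (Finset.univ : Finset (Fin (2 ^ κ))) fun j _ => hr j)).union
      (Derivable.biUnion (Finset.univ : Finset (Fin (2 ^ κ) × Fin β)) fun ik _ => hp ik)
    refine hall.mono (le_of_eq ?_) subset_rfl subset_rfl
    rw [Finset.sum_const, Finset.sum_const, Finset.card_univ, Finset.card_univ, Fintype.card_fin,
      Fintype.card_prod, Fintype.card_fin, Fintype.card_fin, smul_eq_mul, smul_eq_mul]
    ring
  -- Stage 3: the first column `∑ k, P i k * Q 0 k`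
  set B3 : Set K := ⋃ i ∈ (Finset.univ : Finset (Fin (2 ^ κ))), {∑ k : Fin β, P i k * Q 0 k}
    with hB3
  have h3 : Derivable ℂ (2 ^ κ * β) (A ∪ B1 ∪ B2) B3 := by
    have hc : ∀ i : Fin (2 ^ κ), Derivable ℂ β (A ∪ B1 ∪ B2) {∑ k : Fin β, P i k * Q 0 k} := by
      intro i
      have h := Derivable.sum (k := ℂ) (A := A ∪ B1 ∪ B2) (Finset.univ : Finset (Fin β))
        (fun _ => (1 : ℂ)) (x := fun k => P i k * Q 0 k) fun k _ =>
          Or.inl (Or.inr (Or.inr (Set.mem_iUnion₂.2 ⟨(i, k), Finset.mem_univ _, rfl⟩)))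
      rw [Finset.card_univ, Fintype.card_fin] at h
      simpa only [one_smul] using h
    have hall := Derivable.biUnion (Finset.univ : Finset (Fin (2 ^ κ))) fun i _ => hc i
    rwa [Finset.sum_const, Finset.card_univ, Fintype.card_fin, smul_eq_mul] at hall
  -- Stage 4: the three non-trivial generator columns
  have h4 : Derivable ℂ (2 ^ κ + 2 ^ κ + 2 ^ κ * β) (A ∪ B1 ∪ B2 ∪ B3)
      ((⋃ i ∈ (Finset.univ : Finset (Fin (2 ^ κ))),
        {(Matrix.of fun i j : Fin (2 ^ κ) => if (i : ℕ) = (j : ℕ) + 1 then (1 : K) else 0).mulVec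
            cL i - algebraMap ℂ K cf * ∑ k : Fin β, P i k * Q 0 k}) ∪
       (⋃ j ∈ (Finset.univ : Finset (Fin (2 ^ κ))), {algebraMap ℂ K ce * ∑ k : Fin β,
          ∑ a : Fin (2 ^ κ), ∑ b : Fin (2 ^ κ), if (a : ℕ) + b = j then P (Fin.rev a) k * Q b k
            else 0}) ∪
       (⋃ ik ∈ (Finset.univ : Finset (Fin (2 ^ κ) × Fin β)), {-P ik.1 ik.2})) := by
    have hg : ∀ i : Fin (2 ^ κ), Derivable ℂ 1 (A ∪ B1 ∪ B2 ∪ B3)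
        {(Matrix.of fun i j : Fin (2 ^ κ) => if (i : ℕ) = (j : ℕ) + 1 then (1 : K) else 0).mulVec
            cL i - algebraMap ℂ K cf * ∑ k : Fin β, P i k * Q 0 k} := by
      intro i
      have hx : (Matrix.of fun i j : Fin (2 ^ κ) =>
          if (i : ℕ) = (j : ℕ) + 1 then (1 : K) else 0).mulVec cL i ∈
            A ∪ B1 ∪ B2 ∪ B3 ∪ Set.range (algebraMap ℂ K) := by
        rw [conv_shift_mulVec]
        split_ifs with h
        · exact Or.inl (Or.inl (Or.inr (Or.inl (Or.inl
            (Set.mem_iUnion₂.2 ⟨_, Finset.mem_univ _, rfl⟩)))))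
        · exact Or.inr ⟨0, map_zero _⟩
      have h := Derivable.lin (k := ℂ) hx
        (Or.inl (Or.inr (Set.mem_iUnion₂.2 ⟨i, Finset.mem_univ _, rfl⟩))) (1 : ℂ) (-cf)
      rwa [one_smul, neg_smul, Algebra.smul_def, ← sub_eq_add_neg] at h
    have hh : ∀ j : Fin (2 ^ κ), Derivable ℂ 1 (A ∪ B1 ∪ B2 ∪ B3)
        {algebraMap ℂ K ce * ∑ k : Fin β, ∑ a : Fin (2 ^ κ), ∑ b : Fin (2 ^ κ),
          if (a : ℕ) + b = j then P (Fin.rev a) k * Q b k else 0} := by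
      intro j
      have h := Derivable.smul (k := ℂ) (A := A ∪ B1 ∪ B2 ∪ B3)
        (Or.inl (Or.inl (Or.inr (Or.inl (Or.inr
          (Set.mem_iUnion₂.2 ⟨j, Finset.mem_univ _, rfl⟩)))))) ce
      rwa [Algebra.smul_def] at h
    have hn : ∀ ik : Fin (2 ^ κ) × Fin β, Derivable ℂ 1 (A ∪ B1 ∪ B2 ∪ B3) {-P ik.1 ik.2} := by
      intro ik
      have h := Derivable.smul (k := ℂ) (A := A ∪ B1 ∪ B2 ∪ B3)
        (liftA (liftA (liftA (hP ik.1 ik.2)))) (-1 : ℂ)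
      rwa [neg_one_smul] at h
    have hall := ((Derivable.biUnion (Finset.univ : Finset (Fin (2 ^ κ))) fun i _ => hg i).union
      (Derivable.biUnion (Finset.univ : Finset (Fin (2 ^ κ))) fun j _ => hh j)).union
      (Derivable.biUnion (Finset.univ : Finset (Fin (2 ^ κ) × Fin β)) fun ik _ => hn ik)
    refine hall.mono (le_of_eq ?_) subset_rfl subset_rfl
    rw [Finset.sum_const, Finset.sum_const, Finset.card_univ, Finset.card_univ, Fintype.card_fin,
      Fintype.card_prod, Fintype.card_fin, Fintype.card_fin, smul_eq_mul, smul_eq_mul, mul_one,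
      mul_one]
  refine (h1.trans (h2.trans (h3.trans h4))).mono (le_of_eq (by ring)) subset_rfl ?_
  rintro _ ((⟨i, rfl⟩ | ⟨j, rfl⟩) | ⟨ik, rfl⟩)
  · exact Or.inl (Or.inl (Set.mem_iUnion₂.2 ⟨i, Finset.mem_univ _, rfl⟩))
  · exact Or.inl (Or.inr (Set.mem_iUnion₂.2 ⟨j, Finset.mem_univ _, rfl⟩))
  · exact Or.inr (Set.mem_iUnion₂.2 ⟨ik, Finset.mem_univ _, rfl⟩)

/-- **Stub `conversion`** — see `Lines/Sketch.lean`. [cite: Pan2001, §4.7] -/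
theorem stub_conversion (hfft : ∀ (κ : ℕ) (ω : ℂ) (a : ℕ → K) (A : Set K),
      (∀ i < 2 ^ κ, a i ∈ A ∪ Set.range (algebraMap ℂ K)) →
      Derivable ℂ (κ * 2 ^ κ) A {v | ∃ j < 2 ^ κ, v = fft κ (algebraMap ℂ K ω) a j})
    (hpm : ∀ (n : ℕ) (u v : Fin n → K) (A : Set K),
      (∀ i, u i ∈ A ∪ Set.range (algebraMap ℂ K)) → (∀ i, v i ∈ A ∪ Set.range (algebraMap ℂ K)) →
      Derivable ℂ (16 * n * (Nat.log 2 n + 4)) A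
        {w | ∃ m : ℕ, w = ∑ i : Fin n, ∑ j : Fin n, if (i : ℕ) + j = m then u i * v j else 0}) :
    ∀ (κ β : ℕ) (ω ε φ : ℂ), IsPrimitiveRoot ω (2 ^ κ) → ε ≠ 0 → φ ≠ 0 →
      (∀ i j : ℕ, ε * ω ^ i ≠ φ * ω ^ j) →
      ∀ (T : Matrix (Fin (2 ^ κ)) (Fin (2 ^ κ)) K) (P Q : Matrix (Fin (2 ^ κ)) (Fin β) K),
      T - (Matrix.of fun i j : Fin (2 ^ κ) => if (i : ℕ) = (j : ℕ) + 1 then (1 : K) else 0) * T *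
          (Matrix.of fun i j : Fin (2 ^ κ) => if (i : ℕ) = (j : ℕ) + 1 then (1 : K) else 0)ᵀ = P * Qᵀ →
      IsUnit ((Matrix.of fun i j : Fin (2 ^ κ) => algebraMap ℂ K (ε ^ (j : ℕ) * ω ^ ((i : ℕ) * j)))).det ∧
      IsUnit ((Matrix.of fun i j : Fin (2 ^ κ) => algebraMap ℂ K (φ ^ (j : ℕ) * ω ^ ((i : ℕ) * j)))).det ∧
      cauchyLike (fun i : Fin (2 ^ κ) => algebraMap ℂ K (ε * ω ^ (i : ℕ)))
          (fun j : Fin (2 ^ κ) => algebraMap ℂ K (φ * ω ^ (j : ℕ)))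
          ((Matrix.of fun i j : Fin (2 ^ κ) => algebraMap ℂ K (ε ^ (j : ℕ) * ω ^ ((i : ℕ) * j))) *
            (Matrix.fromCols (Matrix.fromCols
            (Matrix.of fun (i : Fin (2 ^ κ)) (_ : Fin 1) =>
              ((Matrix.of fun i j : Fin (2 ^ κ) => if (i : ℕ) = (j : ℕ) + 1 then (1 : K) else 0)).mulVec
                (fun i : Fin (2 ^ κ) => ∑ k : Fin β, ∑ a : Fin (2 ^ κ), ∑ b : Fin (2 ^ κ), if (a : ℕ) + b = i then P a k * Q (Fin.rev b) k else 0) i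
              - algebraMap ℂ K (φ ^ 2 ^ κ) * (fun i : Fin (2 ^ κ) => ∑ k : Fin β, P i k * Q 0 k) i)
            (Matrix.of fun (i : Fin (2 ^ κ)) (_ : Fin 1) => if (i : ℕ) = 0 then (1 : K) else 0))
          (-P)))
          (((Matrix.of fun i j : Fin (2 ^ κ) => algebraMap ℂ K (φ ^ (j : ℕ) * ω ^ ((i : ℕ) * j)))ᵀ)⁻¹ *
            (Matrix.fromCols (Matrix.fromCols
            (Matrix.of fun (j : Fin (2 ^ κ)) (_ : Fin 1) => if (j : ℕ) = 2 ^ κ - 1 then (1 : K) else 0)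
            (Matrix.of fun (j : Fin (2 ^ κ)) (_ : Fin 1) => algebraMap ℂ K (ε ^ 2 ^ κ) *
              (fun j : Fin (2 ^ κ) => ∑ k : Fin β, ∑ a : Fin (2 ^ κ), ∑ b : Fin (2 ^ κ), if (a : ℕ) + b = j then P (Fin.rev a) k * Q b k else 0) j))
          ((Matrix.of fun i j : Fin (2 ^ κ) => if (i : ℕ) = (j : ℕ) + 1 then (1 : K) else 0)ᵀ * Q)))
        = (Matrix.of fun i j : Fin (2 ^ κ) => algebraMap ℂ K (ε ^ (j : ℕ) * ω ^ ((i : ℕ) * j))) * T *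
          ((Matrix.of fun i j : Fin (2 ^ κ) => algebraMap ℂ K (φ ^ (j : ℕ) * ω ^ ((i : ℕ) * j))))⁻¹ ∧
      ∀ (A : Set K), (∀ i k, P i k ∈ A ∪ Set.range (algebraMap ℂ K)) →
        (∀ i k, Q i k ∈ A ∪ Set.range (algebraMap ℂ K)) →
        Derivable ℂ (40 * (β + 2) * (κ + 4) * 2 ^ κ) A
          (Set.range (fun ik : Fin (2 ^ κ) × ((Fin 1 ⊕ Fin 1) ⊕ Fin β) =>
              ((Matrix.of fun i j : Fin (2 ^ κ) => algebraMap ℂ K (ε ^ (j : ℕ) * ω ^ ((i : ℕ) * j))) *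
                (Matrix.fromCols (Matrix.fromCols
            (Matrix.of fun (i : Fin (2 ^ κ)) (_ : Fin 1) =>
              ((Matrix.of fun i j : Fin (2 ^ κ) => if (i : ℕ) = (j : ℕ) + 1 then (1 : K) else 0)).mulVec
                (fun i : Fin (2 ^ κ) => ∑ k : Fin β, ∑ a : Fin (2 ^ κ), ∑ b : Fin (2 ^ κ), if (a : ℕ) + b = i then P a k * Q (Fin.rev b) k else 0) i
              - algebraMap ℂ K (φ ^ 2 ^ κ) * (fun i : Fin (2 ^ κ) => ∑ k : Fin β, P i k * Q 0 k) i)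
            (Matrix.of fun (i : Fin (2 ^ κ)) (_ : Fin 1) => if (i : ℕ) = 0 then (1 : K) else 0))
          (-P))) ik.1 ik.2) ∪
           Set.range (fun ik : Fin (2 ^ κ) × ((Fin 1 ⊕ Fin 1) ⊕ Fin β) =>
              (((Matrix.of fun i j : Fin (2 ^ κ) => algebraMap ℂ K (φ ^ (j : ℕ) * ω ^ ((i : ℕ) * j)))ᵀ)⁻¹ *
                (Matrix.fromCols (Matrix.fromCols
            (Matrix.of fun (j : Fin (2 ^ κ)) (_ : Fin 1) => if (j : ℕ) = 2 ^ κ - 1 then (1 : K) else 0)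
            (Matrix.of fun (j : Fin (2 ^ κ)) (_ : Fin 1) => algebraMap ℂ K (ε ^ 2 ^ κ) *
              (fun j : Fin (2 ^ κ) => ∑ k : Fin β, ∑ a : Fin (2 ^ κ), ∑ b : Fin (2 ^ κ), if (a : ℕ) + b = j then P (Fin.rev a) k * Q b k else 0) j))
          ((Matrix.of fun i j : Fin (2 ^ κ) => if (i : ℕ) = (j : ℕ) + 1 then (1 : K) else 0)ᵀ * Q))) ik.1 ik.2)) := by
  intro κ β ω ε φ hω hε hφ hsep T P Q hT
  have hinj : Function.Injective (algebraMap ℂ K) := (algebraMap ℂ K).injective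
  have hωK : IsPrimitiveRoot (algebraMap ℂ K ω) (2 ^ κ) := hω.map_of_injective hinj
  have hω1 : algebraMap ℂ K ω ^ 2 ^ κ = 1 := hωK.pow_eq_one
  have hεK : algebraMap ℂ K ε ≠ 0 := (map_ne_zero _).2 hε
  have hφK : algebraMap ℂ K φ ≠ 0 := (map_ne_zero _).2 hφ
  have hxy : ∀ i j : Fin (2 ^ κ), algebraMap ℂ K ε * algebraMap ℂ K ω ^ (i : ℕ) ≠
      algebraMap ℂ K φ * algebraMap ℂ K ω ^ (j : ℕ) := by
    intro i j h
    rw [← map_pow, ← map_pow, ← map_mul, ← map_mul] at h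
    exact hsep i j (hinj h)
  -- the three border vectors of `T` in terms of the Stein generator
  have hlast : 2 ^ κ - 1 < 2 ^ κ := Nat.sub_one_lt (NeZero.ne (2 ^ κ))
  have hcL : ∀ i : Fin (2 ^ κ), (∑ k : Fin β, ∑ a : Fin (2 ^ κ), ∑ b : Fin (2 ^ κ),
      if (a : ℕ) + b = i then P a k * Q (Fin.rev b) k else 0) = T i ⟨2 ^ κ - 1, hlast⟩ := by
    intro i
    rw [conv_stein_entry hT i, conv_sum_spec_lastCol (fun a b => ∑ k, P a k * Q b k) i, Finset.sum_comm]
    refine Finset.sum_congr rfl fun a _ => ?_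
    rw [Finset.sum_comm]
    refine Finset.sum_congr rfl fun b _ => ?_
    rw [Finset.sum_ite_irrel, Finset.sum_const_zero]
  have hrL : ∀ j : Fin (2 ^ κ), (∑ k : Fin β, ∑ a : Fin (2 ^ κ), ∑ b : Fin (2 ^ κ),
      if (a : ℕ) + b = j then P (Fin.rev a) k * Q b k else 0) = T ⟨2 ^ κ - 1, hlast⟩ j := by
    intro j
    rw [conv_stein_entry hT _ j, conv_sum_spec_lastRow (fun a b => ∑ k, P a k * Q b k) j, Finset.sum_comm]
    refine Finset.sum_congr rfl fun a _ => ?_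
    rw [Finset.sum_comm]
    refine Finset.sum_congr rfl fun b _ => ?_
    rw [Finset.sum_ite_irrel, Finset.sum_const_zero]
  have hc0 : ∀ i : Fin (2 ^ κ), (∑ k : Fin β, P i k * Q 0 k) = T i 0 := by
    intro i
    rw [conv_stein_entry hT i 0, Fin.val_zero, conv_sum_spec_firstCol (fun a b => ∑ k, P a k * Q b k) i]
  simp only [map_mul, map_pow]
  refine ⟨conv_isUnit_det_twistedDFT hεK hωK, conv_isUnit_det_twistedDFT hφK hωK, ?_, ?_⟩
  · exact conv_cauchyLike_eq_of_intertwining hxy (conv_diagonal_mul_twistedDFT _ _ hω1)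
      (conv_diagonal_mul_twistedDFT _ _ hω1) (conv_isUnit_det_twistedDFT hφK hωK)
      (conv_sylvester_of_stein hT _ _ _ hcL hrL hc0 _ _)
  · intro A hP hQ
    refine ((conv_cost_generators hpm κ β ⟨ε ^ 2 ^ κ, map_pow _ _ _⟩ ⟨φ ^ 2 ^ κ, map_pow _ _ _⟩
      P Q A hP hQ).trans (conv_cost_transforms hfft κ ω ε φ hω hφ _ _ _ ?_ ?_)).mono ?_
      subset_rfl subset_rfl
    · rintro j ((c | c) | k)
      · exact Or.inl (Or.inr (Or.inl (Or.inl ⟨j, rfl⟩)))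
      · refine Or.inr ⟨if (j : ℕ) = 0 then 1 else 0, ?_⟩
        rw [Matrix.fromCols_apply_inl, Matrix.fromCols_apply_inr, Matrix.of_apply]
        split_ifs <;> simp
      · exact Or.inl (Or.inr (Or.inr ⟨(j, k), rfl⟩))
    · rintro j ((c | c) | k)
      · refine Or.inr ⟨if (j : ℕ) = 2 ^ κ - 1 then 1 else 0, ?_⟩
        rw [Matrix.fromCols_apply_inl, Matrix.fromCols_apply_inl, Matrix.of_apply]
        split_ifs <;> simp
      · exact Or.inl (Or.inr (Or.inl (Or.inr ⟨j, rfl⟩)))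
      · rw [Matrix.fromCols_apply_inr, conv_shiftT_mul_apply]
        split_ifs with h
        · exact (hQ _ _).elim (fun h => Or.inl (Or.inl h)) Or.inr
        · exact Or.inr ⟨0, map_zero _⟩
    · rw [Fintype.card_sum, Fintype.card_sum, Fintype.card_fin, Fintype.card_fin]
      exact conv_cost_bound β κ

end KLevel

end

end Summit.MatrixMultiplication.MatrixMultiplication.Theorems
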